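import Summits.MatrixMultiplication.MatrixMultiplication.Theorems.OutsiderSandwichToricCeilingPowThreeCwBaseCensus5A

/-!
# OutsiderSandwich — toric ceiling of `cw₂^{⊠N}`: the `N = 3` three-cw base, PAIR census 5B
(group `cZ5`, part B of 3: 300 of 836 instances; decomp-mm lens 4, gen 47, kernel K47-9 census;
THESES-FREE, `ω`-free; helper toward `LaserTangency`, stmt-32268)

LABEL.  TORIC · FINITE (`N = 3`) · NEC-side instrument.  In CHUNKS of at most 60 instances (kernel
memory / time ceiling on the gate): the certificate pair `datc5[i]` satisfies `goodP₁` for the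
instance `(instOf₁ cZ5)[i]` — both decode to `valid₁` perfect matchings of `cw ⊠ cw ⊠ cw` minus the
instance and the second misses a row of the first (`census₃_5_r`, `decide +kernel`, standard axioms;
no `native_decide`, no `ofReduceBool`).  Consumed by
`…ThreeCwBase`.
WHAT THIS IS NOT: no statement about tensors or `ω`.
-/

set_option linter.dupNamespace false
set_option maxRecDepth 200000
set_option Elab.async false

namespace Summit.MatrixMultiplication.MatrixMultiplication.Theorems.OutsiderSandwichToricCeilingPowThreeCwBaseCensus5B

open Summit.MatrixMultiplication.MatrixMultiplication.Theorems.OutsiderSandwichToricCeilingPowTwoCwBaseDefs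
open Summit.MatrixMultiplication.MatrixMultiplication.Theorems.OutsiderSandwichToricCeilingPowThreeCwBaseDefs
open Summit.MatrixMultiplication.MatrixMultiplication.Theorems.OutsiderSandwichToricCeilingPowThreeCwBaseData5
open Summit.MatrixMultiplication.MatrixMultiplication.Theorems.OutsiderSandwichToricCeilingPowThreeCwBaseCensus5A

set_option maxHeartbeats 0 in
/-- PAIR CENSUS, group `cZ5`, instances `300 … 359` (kernel-decided). -/
theorem census₃_5_5 : ((((instOf₁ cZ5).zip datc5).drop 300).take 60).all
    (fun p => goodP₁ p.1 p.2.1 p.2.2) = true := by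
  decide +kernel

set_option maxHeartbeats 0 in
/-- PAIR CENSUS, group `cZ5`, instances `360 … 419` (kernel-decided). -/
theorem census₃_5_6 : ((((instOf₁ cZ5).zip datc5).drop 360).take 60).all
    (fun p => goodP₁ p.1 p.2.1 p.2.2) = true := by
  decide +kernel

set_option maxHeartbeats 0 in
/-- PAIR CENSUS, group `cZ5`, instances `420 … 479` (kernel-decided). -/
theorem census₃_5_7 : ((((instOf₁ cZ5).zip datc5).drop 420).take 60).all
    (fun p => goodP₁ p.1 p.2.1 p.2.2) = true := by
  decide +kernel

set_option maxHeartbeats 0 in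
/-- PAIR CENSUS, group `cZ5`, instances `480 … 539` (kernel-decided). -/
theorem census₃_5_8 : ((((instOf₁ cZ5).zip datc5).drop 480).take 60).all
    (fun p => goodP₁ p.1 p.2.1 p.2.2) = true := by
  decide +kernel

set_option maxHeartbeats 0 in
/-- PAIR CENSUS, group `cZ5`, instances `540 … 599` (kernel-decided). -/
theorem census₃_5_9 : ((((instOf₁ cZ5).zip datc5).drop 540).take 60).all
    (fun p => goodP₁ p.1 p.2.1 p.2.2) = true := by
  decide +kernel

end Summit.MatrixMultiplication.MatrixMultiplication.Theorems.OutsiderSandwichToricCeilingPowThreeCwBaseCensus5B
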